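import Mathlib
import Summits.CriticalPhenomena.SAWScalingLimit.Theorems.SAWDefectDecoherenceConjugateClassNegligibleSums
import Literature.Barriers.CriticalPhenomena.ParafermionicHalfCauchyRiemann
import Literature.Probability.RandomPlanarGeometry.HexParafermionProofs
import Literature.Probability.RandomPlanarGeometry.ConformalMap
import Literature.Probability.RandomPlanarGeometry.PlanarDomains
import HarnessLib

/-!
# Crux `HexObservableLimitR` (stmt-CriticalPhenomena-14003), line `Ideator1Sketch` — stub `stub_greenLimit`

Registered stub of the lead skeleton `Cruxes/HexObservableLimitR/Lines/Ideator1Sketch.lean`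
(composition `HexObservableLimitR_of`). Target file: `Summits/CriticalPhenomena/SAWScalingLimit/Theorems/SAWDefectDecoherenceHexObservableLimitRGreenLimit.lean`.

Contents (namespace `Summit.CriticalPhenomena.SAWScalingLimit.Theorems.HexObservableLimitR`), helpers
prefixed `greenLimit_`: `fderiv_apply_ofReal_mul` (Wirtinger split `Dχ(z)(δd) = ∂χ (δd) + ∂̄χ (δd̄)`),
`taylor_two` / `taylor_symm` (second-order Taylor bounds for `χ ∈ C³_c`), `green_core` /
`green_weighted` (weighted discrete Green identity: boundary pairing `=`
`Σ_{black v ∼ t ⊂ Λ} (g t - g v) (mid - c_v) F({v,t})`), `identity` (the exact identity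
`S_δ = 6 B_δ - T_δ - 6 E_δ` at scale `δ`, `|mid - c_v|² = 1/12`), `remainder_tendsto` (`E_δ → 0` from the
normalised mass bound); and the stub `stub_greenLimit`.
-/

noncomputable section

namespace Summit.CriticalPhenomena.SAWScalingLimit.Theorems.HexObservableLimitR

open Literature.Probability.RandomPlanarGeometry Literature.Probability.RandomPlanarGeometry.SAW
open Literature.Probability.LatticeModels Literature.Barriers.CriticalPhenomena
open Literature.Barriers.CriticalPhenomena.HexGreen
open Literature.Barriers.CriticalPhenomena.HexKernel (term)
open Summit.CriticalPhenomena.SAWScalingLimit.Theorems.ConjugateClassNegligibleSynthesis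
open Summit.CriticalPhenomena.SAWScalingLimit.Cruxes.DefectDecoherence.TipMartingaleDepthInduction.WallExitTwoPoint
  (normSq_hexCenter_sub_of_adj)
open scoped BigOperators Topology ComplexConjugate
open Filter MeasureTheory Set Metric

/-- Wirtinger splitting of a real derivative along a real multiple of a vector:
`Dχ(z)(δ d) = ∂χ(z) · (δ d) + ∂̄χ(z) · (δ d̄)` for real `δ`, with `∂χ = (Dχ 1 - i Dχ i)/2` and
`∂̄χ = (Dχ 1 + i Dχ i)/2` (decompose `δ d = re • 1 + im • i` and use `ℝ`-linearity). [folklore] -/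
theorem greenLimit_fderiv_apply_ofReal_mul (χ : ℂ → ℂ) (z d : ℂ) (δ : ℝ) :
    fderiv ℝ χ z ((δ : ℂ) * d) =
      (fderiv ℝ χ z 1 - Complex.I * fderiv ℝ χ z Complex.I) / 2 * ((δ : ℂ) * d) +
        (fderiv ℝ χ z 1 + Complex.I * fderiv ℝ χ z Complex.I) / 2 * ((δ : ℂ) * conj d) := by
  set L := fderiv ℝ χ z
  set h := (δ : ℂ) * d with hh_def
  have hc : (δ : ℂ) * conj d = conj h := by rw [hh_def, map_mul, Complex.conj_ofReal]
  rw [hc]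
  have hh : h = h.re • (1 : ℂ) + h.im • Complex.I := by
    rw [Complex.real_smul, Complex.real_smul, mul_one, Complex.re_add_im]
  conv_lhs => rw [hh, map_add, map_smul, map_smul]
  conv_rhs => rw [hh]
  simp only [Complex.real_smul, map_add, map_mul, Complex.conj_ofReal, Complex.conj_I, mul_one]
  linear_combination ((h.im : ℂ) * L Complex.I) * Complex.I_sq

/-- Second-order Taylor bound for a `C³` function of compact support: its derivative is Lipschitz
(`ContDiff.lipschitzWith_of_hasCompactSupport`), so by the mean value inequality applied to
`y ↦ χ y - Dχ(z) y` on the ball `B̄(z, ‖h‖)`, `‖χ(z+h) - χ(z) - Dχ(z) h‖ ≤ M ‖h‖²`. [folklore] -/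
theorem greenLimit_taylor_two {χ : ℂ → ℂ} (hχ : ContDiff ℝ 3 χ) (hχs : HasCompactSupport χ) :
    ∃ M : ℝ, 0 ≤ M ∧ ∀ z h : ℂ, ‖χ (z + h) - χ z - fderiv ℝ χ z h‖ ≤ M * ‖h‖ ^ 2 := by
  have hd : ContDiff ℝ 1 (fderiv ℝ χ) := hχ.fderiv_right (by norm_num)
  obtain ⟨K, hK⟩ := hd.lipschitzWith_of_hasCompactSupport (hχs.fderiv ℝ) one_ne_zero
  have hdiff : Differentiable ℝ χ := hχ.differentiable (by norm_num)
  refine ⟨K, K.2, fun z h => ?_⟩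
  have key := (convex_closedBall z ‖h‖).norm_image_sub_le_of_norm_hasFDerivWithin_le
    (f := fun y => χ y - fderiv ℝ χ z y) (f' := fun y => fderiv ℝ χ y - fderiv ℝ χ z)
    (x := z) (y := z + h) (C := K * ‖h‖)
    (fun y _ => ((hdiff y).hasFDerivAt.sub (fderiv ℝ χ z).hasFDerivAt).hasFDerivWithinAt)
    (fun y hy => by
      rw [← dist_eq_norm]
      exact (hK.dist_le_mul y z).trans (by gcongr; exact mem_closedBall.1 hy))
    (mem_closedBall_self (norm_nonneg h)) (by simp [mem_closedBall, dist_eq_norm])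
  have e : (χ (z + h) - fderiv ℝ χ z (z + h)) - (χ z - fderiv ℝ χ z z) =
      χ (z + h) - χ z - fderiv ℝ χ z h := by
    rw [map_add]; ring
  rw [e, add_sub_cancel_left] at key
  calc ‖χ (z + h) - χ z - fderiv ℝ χ z h‖ ≤ K * ‖h‖ * ‖h‖ := key
    _ = K * ‖h‖ ^ 2 := by ring

/-- Symmetric second-order Taylor bound: `‖χ(z+h) - χ(z-h) - 2 Dχ(z) h‖ ≤ M ‖h‖²` for a `C³`
function of compact support. [folklore] -/
theorem greenLimit_taylor_symm {χ : ℂ → ℂ} (hχ : ContDiff ℝ 3 χ) (hχs : HasCompactSupport χ) :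
    ∃ M : ℝ, 0 ≤ M ∧ ∀ z h : ℂ,
      ‖χ (z + h) - χ (z - h) - 2 * fderiv ℝ χ z h‖ ≤ M * ‖h‖ ^ 2 := by
  obtain ⟨M, hM0, hM⟩ := greenLimit_taylor_two hχ hχs
  refine ⟨2 * M, by positivity, fun z h => ?_⟩
  have h1 := hM z h
  have h2 := hM z (-h)
  rw [map_neg, norm_neg, ← sub_eq_add_neg] at h2
  have e : χ (z + h) - χ (z - h) - 2 * fderiv ℝ χ z h =
      (χ (z + h) - χ z - fderiv ℝ χ z h) - (χ (z - h) - χ z - -fderiv ℝ χ z h) := by ring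
  rw [e]
  calc _ ≤ ‖χ (z + h) - χ z - fderiv ℝ χ z h‖ + ‖χ (z - h) - χ z - -fderiv ℝ χ z h‖ :=
        norm_sub_le _ _
    _ ≤ M * ‖h‖ ^ 2 + M * ‖h‖ ^ 2 := add_le_add h1 h2
    _ = 2 * M * ‖h‖ ^ 2 := by ring

/-- Bipartite re-indexing: a sum over ordered adjacent pairs of `Λ` is the sum over black→white
pairs of the symmetrised summand (a neighbour of a black vertex is white, `snd_ne_of_adj`).
[folklore] -/
theorem greenLimit_sum_adj_eq_sum_black {M : Type*} [AddCommMonoid M] (Λ : Finset HexVertex)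
    (A : HexVertex → HexVertex → M) :
    ∑ v ∈ Λ, ∑ w ∈ Λ.filter (fun w => hexGraph.Adj v w), A v w =
      ∑ v ∈ Λ.filter (fun v => v.2 = 0), ∑ t ∈ Λ.filter (fun t => hexGraph.Adj v t),
        (A v t + A t v) := by
  rw [← Finset.sum_filter_add_sum_filter_not Λ (fun v => v.2 = 0)
    (fun v => ∑ w ∈ Λ.filter (fun w => hexGraph.Adj v w), A v w)]
  simp only [Finset.sum_add_distrib]
  congr 1
  refine Finset.sum_comm' fun v w => ?_
  simp only [Finset.mem_filter]
  constructor
  · rintro ⟨⟨hv, hv0⟩, hw, hadj⟩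
    exact ⟨⟨hv, hadj.symm⟩, hw,
      (by decide : ∀ i j : Fin 2, ¬i = 0 → i ≠ j → j = 0) _ _ hv0 (snd_ne_of_adj hadj)⟩
  · rintro ⟨⟨hv, hadj⟩, hw, hw0⟩
    exact ⟨⟨hv, fun hv0 => snd_ne_of_adj hadj (hw0.trans hv0.symm)⟩, hw, hadj.symm⟩

/-- **Weighted Green identity.** If `F` satisfies the vertex relations `Σ_{w ∼ v} term F v w = 0`
at every `v ∈ Λ`, then for every weight `g` the boundary pairing
`Σ_{v ∈ Λ} Σ_{u ∼ v, u ∉ Λ} g v · term F v u` equals `Σ_{black v ∼ t, v, t ∈ Λ} (g t - g v) · term F v t`: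
split the relation at `v` into inside/outside neighbours, and symmetrise the inside double sum
with `term F v t + term F t v = 0`. [cite: DuminilCopinSmirnov2012, §3] -/
theorem greenLimit_green_core (Λ : Finset HexVertex) (F : Sym2 HexVertex → ℂ) (g : HexVertex → ℂ)
    (hF : ∀ v ∈ Λ, ∑ w ∈ nbrs v, term F v w = 0) :
    ∑ v ∈ Λ, ∑ u ∈ (nbrs v).filter (· ∉ Λ), g v * term F v u =
      ∑ v ∈ Λ.filter (fun v => v.2 = 0), ∑ t ∈ Λ.filter (fun t => hexGraph.Adj v t),
        (g t - g v) * term F v t := by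
  have hsplit : ∀ v ∈ Λ, ∑ u ∈ (nbrs v).filter (· ∉ Λ), g v * term F v u =
      -∑ w ∈ Λ.filter (fun w => hexGraph.Adj v w), g v * term F v w := by
    intro v hv
    have h0 : ∑ w ∈ nbrs v, g v * term F v w = 0 := by
      rw [← Finset.mul_sum, hF v hv, mul_zero]
    rw [← Finset.sum_filter_add_sum_filter_not (nbrs v) (· ∈ Λ)] at h0
    have hin : (nbrs v).filter (· ∈ Λ) = Λ.filter (fun w => hexGraph.Adj v w) := by
      ext w
      simp only [Finset.mem_filter, mem_nbrs_iff]
      tauto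
    rw [hin] at h0
    linear_combination h0
  rw [Finset.sum_congr rfl hsplit, Finset.sum_neg_distrib, greenLimit_sum_adj_eq_sum_black,
    ← Finset.sum_neg_distrib]
  refine Finset.sum_congr rfl fun v _ => ?_
  rw [← Finset.sum_neg_distrib]
  refine Finset.sum_congr rfl fun t _ => ?_
  linear_combination (-(g t)) * term_add_term_swap F v t

/-- The weighted Green identity with weight `g v = χ(δ c_v)`, the contributions written out and
divided by a normalising constant `c`. [cite: DuminilCopinSmirnov2012, §3] -/
theorem greenLimit_green_weighted (Λ : Finset HexVertex) (F : Sym2 HexVertex → ℂ) (χ : ℂ → ℂ)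
    (δ c : ℂ) (hF : ∀ v ∈ Λ, ∑ w ∈ nbrs v, term F v w = 0) :
    ∑ v ∈ Λ, ∑ u ∈ (nbrs v).filter (· ∉ Λ),
        χ (δ * hexCenter v) * ((hexMidpoint s(v, u) - hexCenter v) * F s(v, u)) / c =
      ∑ v ∈ Λ.filter (fun v => v.2 = 0), ∑ t ∈ Λ.filter (fun t => hexGraph.Adj v t),
        (χ (δ * hexCenter t) - χ (δ * hexCenter v)) *
          ((hexMidpoint s(v, t) - hexCenter v) * F s(v, t)) / c := by
  simp only [← Finset.sum_div]
  congr 1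
  exact greenLimit_green_core Λ F (fun v => χ (δ * hexCenter v)) hF

/-- `(mid - c_v) · conj (mid - c_v) = |mid - c_v|² = 1/12` for adjacent `v ∼ t` (edge length `1/√3`).
[folklore] -/
theorem greenLimit_mul_conj_mid_sub_center {v t : HexVertex} (h : hexGraph.Adj v t) :
    (hexMidpoint s(v, t) - hexCenter v) * conj (hexMidpoint s(v, t) - hexCenter v) = 1 / 12 := by
  rw [Complex.mul_conj, hexMidpoint_sub_hexCenter, map_div₀, normSq_hexCenter_sub_of_adj h]
  norm_num [Complex.normSq_apply]

/-- The per-pair algebra: with `g t - g v = 2 L(δ d) + R`, `L h = P h + Q h̄` and `d d̄ = 1/12`,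
`δ (g t - g v) d A / F_b = (1/6)(12 d² P w) + (1/6)(Q w) + R d (δ A / F_b)`, `w = δ² A / F_b`.
[folklore] -/
theorem greenLimit_pair_algebra {δ P Q d dc A Fb gt gv Lh : ℂ}
    (h2 : Lh = P * (δ * d) + Q * (δ * dc)) (h4 : d * dc = 1 / 12) :
    δ * ((gt - gv) * (d * A) / Fb) =
      6⁻¹ * (12 * d ^ 2 * P * (δ ^ 2 * A / Fb)) + 6⁻¹ * (Q * (δ ^ 2 * A / Fb)) +
        (gt - gv - 2 * Lh) * d * (δ * A / Fb) := by
  rw [h2]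
  linear_combination (2 * Q * δ ^ 2 * A / Fb) * h4

/-- Summing a per-term identity `c X = T/6 + S/6 + E` over a double finite sum and solving for the
`S`-sum. [folklore] -/
theorem greenLimit_mul_sum_sum_eq {ι κ : Type*} (s : Finset ι) (t : ι → Finset κ) (c : ℂ)
    (X T S E : ι → κ → ℂ)
    (h : ∀ i ∈ s, ∀ j ∈ t i, c * X i j = 6⁻¹ * T i j + 6⁻¹ * S i j + E i j) :
    ∑ i ∈ s, ∑ j ∈ t i, S i j =
      6 * (c * ∑ i ∈ s, ∑ j ∈ t i, X i j) - ∑ i ∈ s, ∑ j ∈ t i, T i j -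
        6 * ∑ i ∈ s, ∑ j ∈ t i, E i j := by
  have key : c * ∑ i ∈ s, ∑ j ∈ t i, X i j =
      6⁻¹ * ∑ i ∈ s, ∑ j ∈ t i, T i j + 6⁻¹ * ∑ i ∈ s, ∑ j ∈ t i, S i j +
        ∑ i ∈ s, ∑ j ∈ t i, E i j := by
    rw [Finset.mul_sum, Finset.mul_sum, Finset.mul_sum, ← Finset.sum_add_distrib,
      ← Finset.sum_add_distrib]
    refine Finset.sum_congr rfl fun i hi => ?_
    rw [Finset.mul_sum, Finset.mul_sum, Finset.mul_sum, ← Finset.sum_add_distrib,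
      ← Finset.sum_add_distrib]
    exact Finset.sum_congr rfl fun j hj => h i hi j hj
  linear_combination (-6) * key

/-- **The discrete Green identity at scale `δ`, Taylor-expanded at the mid-edges.** If `F` satisfies
the vertex relations on `Λ`, then for every `χ`, `δ` and normalising constant `F_b`, with
`∂̄χ = (Dχ 1 + i Dχ i)/2`, `∂χ = (Dχ 1 - i Dχ i)/2`, `d = mid - c_v`, `u = 12 d²` and the symmetric
Taylor remainder `R = χ(δ c_t) - χ(δ c_v) - 2 Dχ(δ mid)(δ d)`:
`Σ_{b→w} ∂̄χ(δ mid) δ²F/F_b = 6 δ Σ_{v, u ∉ Λ} χ(δ c_v) term F v u / F_b - Σ_{b→w} u ∂χ(δ mid) δ²F/F_b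
 - 6 Σ_{b→w} R d δ F/F_b` (weighted Green identity, `Dχ h = ∂χ h + ∂̄χ h̄`, `|d|² = 1/12`).
[cite: DuminilCopinSmirnov2012, §3] -/
theorem greenLimit_identity (Λ : Finset HexVertex) (F : Sym2 HexVertex → ℂ) (Fb : ℂ)
    (δ : ℝ) (χ : ℂ → ℂ) (hF : ∀ v ∈ Λ, ∑ w ∈ nbrs v, term F v w = 0) :
    ∑ v ∈ Λ.filter (fun v => v.2 = 0), ∑ t ∈ Λ.filter (fun t => hexGraph.Adj v t),
        (fderiv ℝ χ ((δ : ℂ) * hexMidpoint s(v, t)) 1 +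
              Complex.I * fderiv ℝ χ ((δ : ℂ) * hexMidpoint s(v, t)) Complex.I) / 2 *
          ((δ : ℂ) ^ 2 * F s(v, t) / Fb) =
      6 * ((δ : ℂ) * ∑ v ∈ Λ, ∑ u ∈ (nbrs v).filter (· ∉ Λ),
          χ ((δ : ℂ) * hexCenter v) * ((hexMidpoint s(v, u) - hexCenter v) * F s(v, u)) / Fb) -
        ∑ v ∈ Λ.filter (fun v => v.2 = 0), ∑ t ∈ Λ.filter (fun t => hexGraph.Adj v t),
          (12 * (hexMidpoint s(v, t) - hexCenter v) ^ 2) *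
            ((fderiv ℝ χ ((δ : ℂ) * hexMidpoint s(v, t)) 1 -
                Complex.I * fderiv ℝ χ ((δ : ℂ) * hexMidpoint s(v, t)) Complex.I) / 2) *
            ((δ : ℂ) ^ 2 * F s(v, t) / Fb) -
        6 * ∑ v ∈ Λ.filter (fun v => v.2 = 0), ∑ t ∈ Λ.filter (fun t => hexGraph.Adj v t),
          (χ ((δ : ℂ) * hexCenter t) - χ ((δ : ℂ) * hexCenter v) -
              2 * fderiv ℝ χ ((δ : ℂ) * hexMidpoint s(v, t))
                ((δ : ℂ) * (hexMidpoint s(v, t) - hexCenter v))) *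
            (hexMidpoint s(v, t) - hexCenter v) * ((δ : ℂ) * F s(v, t) / Fb) := by
  rw [greenLimit_green_weighted Λ F χ (δ : ℂ) Fb hF]
  refine greenLimit_mul_sum_sum_eq _ _ _ _ _ _ _ fun v _ t ht => ?_
  have hadj : hexGraph.Adj v t := (Finset.mem_filter.1 ht).2
  exact greenLimit_pair_algebra
    (greenLimit_fderiv_apply_ofReal_mul χ ((δ : ℂ) * hexMidpoint s(v, t))
      (hexMidpoint s(v, t) - hexCenter v) δ)
    (greenLimit_mul_conj_mid_sub_center hadj)

/-- Elementary bookkeeping for the remainder term: `‖R‖ ≤ M (δ‖d‖)²`, `‖d‖ ≤ 1/2` give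
`‖R‖ ‖d‖ (δ X) ≤ (M/8) δ (δ² X)`. [folklore] -/
theorem greenLimit_aux_ineq {nR nd δ X M : ℝ} (hR : nR ≤ M * (δ * nd) ^ 2) (hd : nd ≤ 1 / 2)
    (hnd : 0 ≤ nd) (hδ : 0 ≤ δ) (hX : 0 ≤ X) (hM : 0 ≤ M) :
    nR * nd * (δ * X) ≤ M / 8 * δ * (δ ^ 2 * X) := by
  calc nR * nd * (δ * X) ≤ M * (δ * nd) ^ 2 * nd * (δ * X) := by gcongr
    _ = M * δ ^ 3 * X * nd ^ 3 := by ring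
    _ ≤ M * δ ^ 3 * X * (1 / 2) ^ 3 := by gcongr
    _ = M / 8 * δ * (δ ^ 2 * X) := by ring

/-- **Remainder bound.** For `0 < δ ≤ r`, the Taylor remainder pairing is bounded by
`(M/8) δ` times the normalised mass of the pairs whose rescaled midpoint lies in the `r`-thickening
of `supp χ` (elsewhere the remainder vanishes identically: both rescaled endpoints are within `δ/2`
of the rescaled midpoint, and `Dχ = 0` off `tsupport χ`). [folklore] -/
theorem greenLimit_remainder_norm_le (Λ : Finset HexVertex) (F : Sym2 HexVertex → ℂ) (Fb : ℂ)
    {δ r M : ℝ} (χ : ℂ → ℂ) (hδ : 0 < δ) (hδr : δ ≤ r) (hM0 : 0 ≤ M)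
    (hM : ∀ z h : ℂ, ‖χ (z + h) - χ (z - h) - 2 * fderiv ℝ χ z h‖ ≤ M * ‖h‖ ^ 2) :
    ‖∑ v ∈ Λ.filter (fun v => v.2 = 0), ∑ t ∈ Λ.filter (fun t => hexGraph.Adj v t),
        (χ ((δ : ℂ) * hexCenter t) - χ ((δ : ℂ) * hexCenter v) -
            2 * fderiv ℝ χ ((δ : ℂ) * hexMidpoint s(v, t))
              ((δ : ℂ) * (hexMidpoint s(v, t) - hexCenter v))) *
          (hexMidpoint s(v, t) - hexCenter v) * ((δ : ℂ) * F s(v, t) / Fb)‖ ≤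
      M / 8 * δ * ∑ v ∈ Λ.filter (fun v => v.2 = 0), ∑ t ∈ Λ.filter (fun t => hexGraph.Adj v t),
        (cthickening r (tsupport χ)).indicator (fun _ => ‖(δ : ℂ) ^ 2 * F s(v, t) / Fb‖)
          ((δ : ℂ) * hexMidpoint s(v, t)) := by
  rw [Finset.mul_sum]
  refine (norm_sum_le _ _).trans (Finset.sum_le_sum fun v _ => ?_)
  rw [Finset.mul_sum]
  refine (norm_sum_le _ _).trans (Finset.sum_le_sum fun t ht => ?_)
  have hadj : hexGraph.Adj v t := (Finset.mem_filter.1 ht).2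
  have hct : (δ : ℂ) * hexCenter t =
      δ * hexMidpoint s(v, t) + δ * (hexMidpoint s(v, t) - hexCenter v) := by
    rw [hexMidpoint_mk]; ring
  have hcv : (δ : ℂ) * hexCenter v =
      δ * hexMidpoint s(v, t) - δ * (hexMidpoint s(v, t) - hexCenter v) := by ring
  have hR := hM (δ * hexMidpoint s(v, t)) (δ * (hexMidpoint s(v, t) - hexCenter v))
  rw [← hct, ← hcv, norm_mul, Complex.norm_real, Real.norm_of_nonneg hδ.le] at hR
  by_cases hK : (δ : ℂ) * hexMidpoint s(v, t) ∈ cthickening r (tsupport χ)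
  · rw [indicator_of_mem hK, norm_mul, norm_mul]
    have h1 : ‖(δ : ℂ) * F s(v, t) / Fb‖ = δ * ‖F s(v, t) / Fb‖ := by
      rw [mul_div_assoc, norm_mul, Complex.norm_real, Real.norm_of_nonneg hδ.le]
    have h2 : ‖(δ : ℂ) ^ 2 * F s(v, t) / Fb‖ = δ ^ 2 * ‖F s(v, t) / Fb‖ := by
      rw [mul_div_assoc, norm_mul, norm_pow, Complex.norm_real, Real.norm_of_nonneg hδ.le]
    rw [h1, h2]
    exact greenLimit_aux_ineq hR (norm_hexMidpoint_sub_hexCenter_le hadj) (norm_nonneg _) hδ.le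
      (norm_nonneg _) hM0
  · rw [indicator_of_notMem hK, mul_zero]
    have hm0 : (δ : ℂ) * hexMidpoint s(v, t) ∉ tsupport χ :=
      fun h => hK (self_subset_cthickening _ h)
    have hct0 : χ ((δ : ℂ) * hexCenter t) = 0 := by
      refine image_eq_zero_of_notMem_tsupport fun h => hK ?_
      exact mem_cthickening_of_dist_le _ _ _ _ h
        ((dist_mid_center_le' hδ.le hadj).trans (by linarith))
    have hcv0 : χ ((δ : ℂ) * hexCenter v) = 0 := by
      refine image_eq_zero_of_notMem_tsupport fun h => hK ?_
      exact mem_cthickening_of_dist_le _ _ _ _ h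
        ((dist_mid_center_le hδ.le hadj).trans (by linarith))
    rw [hct0, hcv0, fderiv_of_notMem_tsupport ℝ hm0]
    simp

/-- **The remainder pairing tends to zero** along `δ ↓ 0`, given the eventual normalised mass bound
on the `r`-thickening of `supp χ`: it is `O(δ)`. [folklore] -/
theorem greenLimit_remainder_tendsto (Λ : ℝ → Finset HexVertex) (F : ℝ → Sym2 HexVertex → ℂ) (Fb : ℝ → ℂ)
    {χ : ℂ → ℂ} {M r C : ℝ} (hr : 0 < r) (hM0 : 0 ≤ M)
    (hM : ∀ z h : ℂ, ‖χ (z + h) - χ (z - h) - 2 * fderiv ℝ χ z h‖ ≤ M * ‖h‖ ^ 2)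
    (hC : ∀ᶠ δ : ℝ in 𝓝[>] 0,
      ∑ v ∈ (Λ δ).filter (fun v => v.2 = 0), ∑ t ∈ (Λ δ).filter (fun t => hexGraph.Adj v t),
        (cthickening r (tsupport χ)).indicator (fun _ => ‖(δ : ℂ) ^ 2 * F δ s(v, t) / Fb δ‖)
          ((δ : ℂ) * hexMidpoint s(v, t)) ≤ C) :
    Tendsto (fun δ : ℝ =>
      ∑ v ∈ (Λ δ).filter (fun v => v.2 = 0), ∑ t ∈ (Λ δ).filter (fun t => hexGraph.Adj v t),
        (χ ((δ : ℂ) * hexCenter t) - χ ((δ : ℂ) * hexCenter v) -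
            2 * fderiv ℝ χ ((δ : ℂ) * hexMidpoint s(v, t))
              ((δ : ℂ) * (hexMidpoint s(v, t) - hexCenter v))) *
          (hexMidpoint s(v, t) - hexCenter v) * ((δ : ℂ) * F δ s(v, t) / Fb δ))
      (𝓝[>] 0) (𝓝 0) := by
  refine squeeze_zero_norm' (a := fun δ : ℝ => M / 8 * C * δ) ?_ ?_
  · filter_upwards [hC, Ioc_mem_nhdsGT hr] with δ hδC hδr
    refine (greenLimit_remainder_norm_le (Λ δ) (F δ) (Fb δ) χ hδr.1 hδr.2 hM0 hM).trans ?_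
    have hδ0 : 0 < δ := hδr.1
    calc _ ≤ M / 8 * δ * C := by gcongr
      _ = M / 8 * C * δ := by ring
  · have h : Tendsto (fun δ : ℝ => M / 8 * C * δ) (𝓝 0) (𝓝 0) :=
      (continuous_const.mul continuous_id).tendsto' (0 : ℝ) 0 (by simp)
    exact h.mono_left nhdsWithin_le_nhds

/-- **Green identity in the limit.** Summing DCS Lemma 1 (`DuminilCopinSmirnov2012_lemma1_holds`)
against `χ(δ c_v)` over `v ∈ Λ_δ` (card 1's `WeightedGreenIdentity`): the boundary pairing equals
`Σ_{black v ∼ t, both in Λ_δ} (χ(δ c_t) - χ(δ c_v)) (mid - c_v) F_δ({v,t})`; Taylor at the mid-edge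
(even orders cancel, `|mid - c_v|² = 1/12`) turns the interior side into
`(δ/6) Σ (∂̄χ + u_e ∂χ)(δe) F_δ(e) + O(δ⁴ ‖D³χ‖ Σ|F_δ|)`. Hence, given the mass bound, the twist
null and the boundary flux limit with constant `c'`, the `∂̄`-moments of the normalised interior
measure converge: `δ² Σ_{e ⊂ Λ_δ} ∂̄χ(δe) F_δ(e)/F_δ(b_δ) → 6 c' ∫_Ω ∂̄χ e^{(5/8)(L - L_b)}`. -/
theorem stub_greenLimit (D : DobrushinDomain) (Λ : ℝ → Finset HexVertex) (a b : ℝ → Sym2 HexVertex)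
    (L : ℂ → ℂ) (Lb : ℂ)
    (hdisc : ∀ᶠ δ : ℝ in 𝓝[>] 0, hexDomainSimplyConnected (Λ δ) ∧ a δ ∈ hexDomainBoundary (Λ δ))
    (hMB : ∀ K : Set ℂ, IsCompact K → D.pt 0 ∉ K → ∃ C : ℝ, ∀ᶠ δ : ℝ in 𝓝[>] 0,
      ∑ v ∈ (Λ δ).filter (fun v => v.2 = 0), ∑ t ∈ (Λ δ).filter (fun t => hexGraph.Adj v t),
        K.indicator (fun _ =>
          ‖(δ : ℂ) ^ 2 * hexParafermionicObservable (Λ δ) (a δ) hexCriticalFugacity (5 / 8) s(v, t) /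
              hexParafermionicObservable (Λ δ) (a δ) hexCriticalFugacity (5 / 8) (b δ)‖)
          ((δ : ℂ) * hexMidpoint s(v, t)) ≤ C)
    (hTN : ∀ χ : ℂ → ℂ, ContDiff ℝ 3 χ → HasCompactSupport χ → D.pt 0 ∉ tsupport χ →
      Tendsto (fun δ : ℝ =>
        ∑ v ∈ (Λ δ).filter (fun v => v.2 = 0), ∑ t ∈ (Λ δ).filter (fun t => hexGraph.Adj v t),
          (12 * (hexMidpoint s(v, t) - hexCenter v) ^ 2) *
            ((fderiv ℝ χ ((δ : ℂ) * hexMidpoint s(v, t)) 1 -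
                Complex.I * fderiv ℝ χ ((δ : ℂ) * hexMidpoint s(v, t)) Complex.I) / 2) *
            ((δ : ℂ) ^ 2 * hexParafermionicObservable (Λ δ) (a δ) hexCriticalFugacity (5 / 8) s(v, t) /
              hexParafermionicObservable (Λ δ) (a δ) hexCriticalFugacity (5 / 8) (b δ)))
        (𝓝[>] 0) (𝓝 0))
    (c' : ℂ)
    (hBF : ∀ χ : ℂ → ℂ, ContDiff ℝ 3 χ → HasCompactSupport χ → D.pt 0 ∉ tsupport χ →
      Tendsto (fun δ : ℝ => (δ : ℂ) *
        ∑ v ∈ Λ δ, ∑ u ∈ (nbrs v).filter (· ∉ Λ δ),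
          χ ((δ : ℂ) * hexCenter v) * ((hexMidpoint s(v, u) - hexCenter v) *
            hexParafermionicObservable (Λ δ) (a δ) hexCriticalFugacity (5 / 8) s(v, u)) /
            hexParafermionicObservable (Λ δ) (a δ) hexCriticalFugacity (5 / 8) (b δ))
        (𝓝[>] 0)
        (𝓝 (c' * ∫ z in D.carrier,
          (fderiv ℝ χ z 1 + Complex.I * fderiv ℝ χ z Complex.I) / 2 *
            Complex.exp ((5 / 8 : ℂ) * (L z - Lb))))) :
    ∀ χ : ℂ → ℂ, ContDiff ℝ 3 χ → HasCompactSupport χ → D.pt 0 ∉ tsupport χ →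
      Tendsto (fun δ : ℝ =>
        ∑ p ∈ (((Λ δ).filter fun v => v.2 = 0) ×ˢ Λ δ).filter (fun p => hexGraph.Adj p.1 p.2),
          (fderiv ℝ χ ((δ : ℂ) * hexMidpoint s(p.1, p.2)) 1 +
              Complex.I * fderiv ℝ χ ((δ : ℂ) * hexMidpoint s(p.1, p.2)) Complex.I) / 2 *
            ((δ : ℂ) ^ 2 * hexParafermionicObservable (Λ δ) (a δ) hexCriticalFugacity (5 / 8) s(p.1, p.2) /
              hexParafermionicObservable (Λ δ) (a δ) hexCriticalFugacity (5 / 8) (b δ)))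
        (𝓝[>] 0)
        (𝓝 (6 * c' * ∫ z in D.carrier,
          (fderiv ℝ χ z 1 + Complex.I * fderiv ℝ χ z Complex.I) / 2 *
            Complex.exp ((5 / 8 : ℂ) * (L z - Lb)))) := by
  intro χ hχ hχs hχ0
  -- second-order symmetric Taylor constant
  obtain ⟨M, hM0, hM⟩ := greenLimit_taylor_symm hχ hχs
  -- a compact thickening of `supp χ` avoiding the root, and its normalised mass bound
  obtain ⟨r, hr, hrK⟩ := hχs.isCompact.exists_cthickening_subset_open isOpen_compl_singleton
    (subset_compl_singleton_iff.2 hχ0)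
  obtain ⟨C, hC⟩ := hMB (cthickening r (tsupport χ)) hχs.isCompact.cthickening
    (fun h => hrK h rfl)
  -- DCS Lemma 1: the vertex relations hold eventually
  have hVR : ∀ᶠ δ : ℝ in 𝓝[>] 0, ∀ v ∈ Λ δ,
      ∑ w ∈ nbrs v,
        term (hexParafermionicObservable (Λ δ) (a δ) hexCriticalFugacity (5 / 8)) v w = 0 := by
    filter_upwards [hdisc] with δ hδ
    exact (satisfiesVertexRelations_iff_sum _ _).1
      (lemma1_iff.1 DuminilCopinSmirnov2012_lemma1_holds (Λ δ) hδ.1 (a δ) hδ.2)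
  -- the remainder pairing tends to zero
  have hE := greenLimit_remainder_tendsto Λ
    (fun δ => hexParafermionicObservable (Λ δ) (a δ) hexCriticalFugacity (5 / 8))
    (fun δ => hexParafermionicObservable (Λ δ) (a δ) hexCriticalFugacity (5 / 8) (b δ))
    hr hM0 hM hC
  -- limits of the three pieces
  have hB6 := (hBF χ hχ hχs hχ0).const_mul (6 : ℂ)
  rw [← mul_assoc] at hB6
  have hlim := (hB6.sub (hTN χ hχ hχs hχ0)).sub (hE.const_mul (6 : ℂ))
  rw [sub_zero, mul_zero, sub_zero] at hlim
  -- the exact identity, eventually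
  simp only [sum_pairFinset_eq]
  refine hlim.congr' ?_
  filter_upwards [hVR] with δ hδ
  exact (greenLimit_identity (Λ δ) _ _ δ χ hδ).symm

end Summit.CriticalPhenomena.SAWScalingLimit.Theorems.HexObservableLimitR

end
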